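import Literature.MathematicalPhysics.QuantumLattice.GrassmannZoneLipschitzDB
import Literature.Probability.LatticeModels.SubmultiplicativeTreeWeight
import Literature.MathematicalPhysics.QuantumLattice.GrassmannSupportSplit
import HarnessLib

/-!
# Interaction defects that are SMALL AT DEEP PINS and arbitrary near a zone: the effective actions agree at deeper pins

Topic `MathematicalPhysics/QuantumLattice`; assembles `GrassmannSupportSplit` (split `D = D_small + D_big` by the support of the monomials),
`GrassmannEffectiveActionLipschitzDB` (homogeneous Lipschitz bound, for `D_small`) and `GrassmannZoneLipschitzDB` (zone bound with diameter weights, for `D_big`, which touches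
the complement of the deep region).  This is the INTERACTION bracket of one step of the inductive nested two-volume comparison of effective actions
(Benfatto–Giuliani–Mastropietro 2006, (2.86)–(2.90) with the moments of §3): the fine previous action `V + D` and the glued coarse one `V` differ by `D`,
whose pinned profile is `≤ E` at the pins of the deep region `P` (induction hypothesis) and merely bounded (`φ(diam)`-weighted profile `N_D`) elsewhere;
at a pin `w` at `d`-distance `≥ R` from the complement of `P`,
`Σ_{X : X_i = w} ‖kernel_m (effAction C (V + D)) (X) − kernel_m (effAction C V) (X)‖ ≤ ρ^{-m} e (‖E‖_h /(1 − θ₁)² + φ(R)⁻¹ ‖N_D‖_h /(1 − θ₂)²)`.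

* **`sum_norm_kernel_effAction_add_sub_le_of_deep`** — the displayed bound.

Everything is proved; no definition, no named fact.

## Sources
G. Benfatto, A. Giuliani, V. Mastropietro, Ann. Henri Poincaré 7 (2006) 809–898, (2.86)–(2.90), §3 (3.2)–(3.8) [`BenfattoGiulianiMastropietro2006`].
-/

noncomputable section

namespace Literature.MathematicalPhysics.QuantumLattice

open GrassmannAlgebra Finset Literature.Probability.LatticeModels Literature.Probability.LatticeModels.BattleFederbush

universe u

variable {𝕜 : Type*} [RCLike 𝕜] {Γ : Type u} [Fintype Γ] [DecidableEq Γ] (C : Matrix Γ Γ 𝕜)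

/-- **DEFECT SMALL AT DEEP PINS, ARBITRARY NEAR THE ZONE ⇒ EFFECTIVE ACTIONS CLOSE AT DEEPER PINS** (BGM 2006 (2.86)–(2.90), §3): replica-Gram-bounded `C`
(constant `κ`) with `φ(d)`-weighted row/column sums `≤ α`; even `V`, `D` without constant part; `φ(diam)`-weighted pinned profiles `N_V`, `N_D`; the
UNWEIGHTED pinned profile of `D` at every pin of the deep region `P` at most `E`; two smallness conditions; `w` at `d`-distance `≥ R` from every label
outside `P`.  Then in every degree `m ≥ 1`
`Σ_{X : X_i = w} ‖kernel_m (effAction C (V + D)) X − kernel_m (effAction C V) X‖ ≤ ρ^{-m} e‖E‖/(1−θ₁)² + φ(R)⁻¹ ρ^{-m} e‖N_D‖/(1−θ₂)²`,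
`θ₁ = eα(‖N_V + N_D‖ + ‖E‖)/κ²`, `θ₂ = eα(‖N_V‖ + ‖N_D‖)/κ²` (`‖·‖ = normV Γ κ ρ`). [cite: BenfattoGiulianiMastropietro2006, (2.86)-(2.90) and §3 (3.2)-(3.8)] -/
theorem sum_norm_kernel_effAction_add_sub_le_of_deep {κ : ℝ} (hκ : 0 < κ) (hGB : IsGramBoundedR C κ)
    (d : Γ → Γ → ℝ) (hd : IsLabelDist d) {φ : ℝ → ℝ} (h1 : ∀ s, 0 ≤ s → 1 ≤ φ s) (hmono : ∀ s t, 0 ≤ s → s ≤ t → φ s ≤ φ t)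
    (hsub : ∀ s t, 0 ≤ s → 0 ≤ t → φ (s + t) ≤ φ s * φ t)
    (V D : GrassmannAlgebra 𝕜 Γ) (hV : V ∈ evenPart 𝕜 Γ) (hD : D ∈ evenPart 𝕜 Γ) (hV0 : constPart 𝕜 V = 0) (hD0 : constPart 𝕜 D = 0)
    (NV ND E : ℕ → ℝ) (hNV0 : ∀ m', 0 ≤ NV m') (hND0 : ∀ m', 0 ≤ ND m') (hE0 : ∀ m', 0 ≤ E m')
    (hNV : ∀ m' (j : Fin (2 * m')) (x : Γ), ∑ Y ∈ univ.filter (fun Y : Fin (2 * m') → Γ => Y j = x),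
      ‖kernel 𝕜 V (2 * m') Y‖ * diamWeight φ d (univ.image Y) ≤ NV m')
    (hND : ∀ m' (j : Fin (2 * m')) (x : Γ), ∑ Y ∈ univ.filter (fun Y : Fin (2 * m') → Γ => Y j = x),
      ‖kernel 𝕜 D (2 * m') Y‖ * diamWeight φ d (univ.image Y) ≤ ND m')
    (P : Γ → Prop) [DecidablePred P]
    (hE : ∀ m' (j : Fin (2 * m')) (x : Γ), P x → ∑ Y ∈ univ.filter (fun Y : Fin (2 * m') → Γ => Y j = x), ‖kernel 𝕜 D (2 * m') Y‖ ≤ E m')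
    {α : ℝ} (hα : 0 < α) (hrow : ∀ X, ∑ Y, ‖C X Y‖ * diamWeight φ d {X, Y} ≤ α) (hcol : ∀ Y, ∑ X, ‖C X Y‖ * diamWeight φ d {X, Y} ≤ α)
    {ρ : ℝ} (hρ : 0 < ρ)
    (hθ₁ : Real.exp 1 * α * (normV Γ κ ρ (fun m' => NV m' + ND m') + normV Γ κ ρ E) / κ ^ 2 < 1)
    (hθ₂ : Real.exp 1 * α * (normV Γ κ ρ NV + normV Γ κ ρ ND) / κ ^ 2 < 1)
    (w : Γ) {R : ℝ} (hR : 0 ≤ R) (hw : ∀ z, ¬ P z → R ≤ d z w) {m : ℕ} (hm : 0 < m) (i : Fin m) :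
    ∑ X ∈ univ.filter (fun X : Fin m → Γ => X i = w), ‖kernel 𝕜 (effAction 𝕜 C (V + D)) m X - kernel 𝕜 (effAction 𝕜 C V) m X‖ ≤
      ρ⁻¹ ^ m * (Real.exp 1 * normV Γ κ ρ E) / (1 - Real.exp 1 * α * (normV Γ κ ρ (fun m' => NV m' + ND m') + normV Γ κ ρ E) / κ ^ 2) ^ 2 +
        (φ R)⁻¹ * (ρ⁻¹ ^ m * (Real.exp 1 * normV Γ κ ρ ND) / (1 - Real.exp 1 * α * (normV Γ κ ρ NV + normV Γ κ ρ ND) / κ ^ 2) ^ 2) := by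
  have hwt : IsTreeWeight (diamWeight φ d) := isTreeWeight_diamWeight hd h1 hmono hsub
  -- the support split `D = Ds + Db`
  set Ds : GrassmannAlgebra 𝕜 Γ := supportPart 𝕜 P D with hDs
  set Db : GrassmannAlgebra 𝕜 Γ := D - supportPart 𝕜 P D with hDb
  have hsplit : V + D = V + Db + Ds := by rw [hDb, hDs]; abel
  have hDs_even : Ds ∈ evenPart 𝕜 Γ := supportPart_mem_evenPart 𝕜 P hD
  have hDb_even : Db ∈ evenPart 𝕜 Γ := sub_mem hD hDs_even
  have hDs0 : constPart 𝕜 Ds = 0 := by rw [hDs, constPart_supportPart, hD0]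
  have hDb0 : constPart 𝕜 Db = 0 := by rw [hDb, map_sub, constPart_supportPart, hD0, sub_zero]
  have hVDb_even : V + Db ∈ evenPart 𝕜 Γ := add_mem hV hDb_even
  have hVDb0 : constPart 𝕜 (V + Db) = 0 := by rw [map_add, hV0, hDb0, add_zero]
  -- unweighted data
  have hrowu : ∀ X, ∑ Y, ‖C X Y‖ ≤ α := fun X =>
    (sum_le_sum fun Y _ => le_mul_of_one_le_right (norm_nonneg _) (hwt.one_le _)).trans (hrow X)
  have hcolu : ∀ Y, ∑ X, ‖C X Y‖ ≤ α := fun Y =>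
    (sum_le_sum fun X _ => le_mul_of_one_le_right (norm_nonneg _) (hwt.one_le _)).trans (hcol Y)
  -- profiles of the pieces
  have hDs_prof : ∀ m' (j : Fin (2 * m')) (x : Γ), ∑ Y ∈ univ.filter (fun Y : Fin (2 * m') → Γ => Y j = x), ‖kernel 𝕜 Ds (2 * m') Y‖ ≤ E m' := by
    intro m' j x
    have hle := sum_filter_norm_kernel_supportPart_mul_le P D (2 * m') j x (fun _ => (1 : ℝ)) (fun _ => zero_le_one)
    simp only [mul_one] at hle
    rw [← hDs] at hle
    by_cases hx : P x
    · exact hle.trans (hE m' j x hx)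
    · have hze := sum_filter_norm_kernel_supportPart_eq_zero_of_not P D (2 * m') j hx (fun _ => (1 : ℝ))
      simp only [mul_one] at hze
      rw [← hDs] at hze
      rw [hze]
      exact hE0 m'
  have hDb_wprof : ∀ m' (j : Fin (2 * m')) (x : Γ), ∑ Y ∈ univ.filter (fun Y : Fin (2 * m') → Γ => Y j = x),
      ‖kernel 𝕜 Db (2 * m') Y‖ * diamWeight φ d (univ.image Y) ≤ ND m' := by
    intro m' j x
    have h := (sum_filter_norm_kernel_sub_supportPart_mul_le P D (2 * m') j x (fun Y => diamWeight φ d (univ.image Y))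
      fun Y => hwt.nonneg _).trans (hND m' j x)
    rw [← hDb] at h
    exact h
  have hVDb_prof : ∀ m' (j : Fin (2 * m')) (x : Γ), ∑ Y ∈ univ.filter (fun Y : Fin (2 * m') → Γ => Y j = x),
      ‖kernel 𝕜 (V + Db) (2 * m') Y‖ ≤ (fun m' => NV m' + ND m') m' := by
    intro m' j x
    calc ∑ Y ∈ univ.filter (fun Y : Fin (2 * m') → Γ => Y j = x), ‖kernel 𝕜 (V + Db) (2 * m') Y‖
        ≤ ∑ Y ∈ univ.filter (fun Y : Fin (2 * m') → Γ => Y j = x),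
            (‖kernel 𝕜 V (2 * m') Y‖ * diamWeight φ d (univ.image Y) + ‖kernel 𝕜 Db (2 * m') Y‖ * diamWeight φ d (univ.image Y)) := by
          refine sum_le_sum fun Y _ => ?_
          rw [kernel_add]
          refine (norm_add_le _ _).trans (add_le_add ?_ ?_) <;>
            exact le_mul_of_one_le_right (norm_nonneg _) (hwt.one_le _)
      _ ≤ NV m' + ND m' := by rw [sum_add_distrib]; exact add_le_add (hNV m' j x) (hDb_wprof m' j x)
  -- the zone hypothesis for `Db`
  have hZ : ∀ (m' : ℕ) (Y : Fin (2 * m') → Γ), kernel 𝕜 Db (2 * m') Y ≠ 0 → ∃ j, Y j ∈ {z | ¬ P z} := fun m' Y h =>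
    exists_not_of_kernel_sub_supportPart_ne_zero 𝕜 P D h
  -- (1) the small part, homogeneous Lipschitz bound
  have hsmall := (sum_norm_kernel_effAction_add_sub_le_of_gramBounded C hκ hGB (V + Db) Ds hVDb_even hDs_even hVDb0 hDs0
    (fun m' => NV m' + ND m') E (fun m' => add_nonneg (hNV0 m') (hND0 m')) hE0 hVDb_prof hDs_prof hα hrowu hcolu hρ hθ₁).2.2 hm i w
  -- (2) the big part, zone bound
  have hφR : 0 < φ R := zero_lt_one.trans_le (h1 R hR)
  have hΛ : ∀ S : Finset Γ, w ∈ S → (∃ z ∈ S, z ∈ {z | ¬ P z}) → φ R ≤ diamWeight φ d S := by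
    rintro S hwS ⟨z, hzS, hzZ⟩
    exact hmono _ _ hR ((hw z hzZ).trans (le_labelDiam d hzS hwS))
  have hbig' := const_mul_sum_norm_kernel_effAction_add_sub_le_of_gramBounded C hwt hκ hGB V Db hV hDb_even hV0 hDb0 NV ND hNV0 hND0 hNV hDb_wprof
    hα hrow hcol hρ hθ₂ {z | ¬ P z} hZ w hφR.le hΛ hm i
  have hbig : ∑ X ∈ univ.filter (fun X : Fin m → Γ => X i = w),
      ‖kernel 𝕜 (effAction 𝕜 C (V + Db)) m X - kernel 𝕜 (effAction 𝕜 C V) m X‖ ≤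
      (φ R)⁻¹ * (ρ⁻¹ ^ m * (Real.exp 1 * normV Γ κ ρ ND) / (1 - Real.exp 1 * α * (normV Γ κ ρ NV + normV Γ κ ρ ND) / κ ^ 2) ^ 2) := by
    rw [le_inv_mul_iff₀ hφR]; exact hbig'
  -- assemble
  calc ∑ X ∈ univ.filter (fun X : Fin m → Γ => X i = w), ‖kernel 𝕜 (effAction 𝕜 C (V + D)) m X - kernel 𝕜 (effAction 𝕜 C V) m X‖
      ≤ ∑ X ∈ univ.filter (fun X : Fin m → Γ => X i = w),
          (‖kernel 𝕜 (effAction 𝕜 C (V + Db + Ds)) m X - kernel 𝕜 (effAction 𝕜 C (V + Db)) m X‖ +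
            ‖kernel 𝕜 (effAction 𝕜 C (V + Db)) m X - kernel 𝕜 (effAction 𝕜 C V) m X‖) := by
        refine sum_le_sum fun X _ => ?_
        rw [hsplit]
        exact norm_sub_le_norm_sub_add_norm_sub _ _ _
    _ ≤ _ := by rw [sum_add_distrib]; exact add_le_add hsmall hbig

end Literature.MathematicalPhysics.QuantumLattice

end
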